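import Summits.BirchSwinnertonDyer.BirchSwinnertonDyer.Theorems.GoldfeldAllTwistsTwoConverseTwinAdditiveTwoInertThreeTwistDescent
import Summits.BirchSwinnertonDyer.BirchSwinnertonDyer.Theorems.GoldfeldAllTwistsTwoConverseTwinAdditiveTwoInertSevenTwistDescent
import Summits.BirchSwinnertonDyer.BirchSwinnertonDyer.Theorems.GoldfeldAllTwistsTwoConverseTwinBirchLemmaKrizLi7TwoPrime
import Summits.BirchSwinnertonDyer.BirchSwinnertonDyer.Theorems.Rank2ShaTierKitM4
import Literature.NumberTheory.EllipticCurves.LutzNagellGeneralWeierstrass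
import Literature.NumberTheory.EllipticCurves.RationalPointInfiniteOrderCriteria
import HarnessLib

set_option linter.dupNamespace false
set_option autoImplicit false

/-!
# Crux `PrintCf2.SplitBadTwoRankOneOfFacts` (stmt-BirchSwinnertonDyer-20368), road α = line `rubin_value_two` (parent skeleton
# of record v5 `d1eb21d31f9bc683`, LEAD g8), stub `stub_anchor_two_kit` (S4b): the ANCHORS of the two remaining 2-adic keys,
# **(0,5) via `d₀ = −6`** and **(0,1) via `d₀ = −62`**, kernel part (a) — `49a1^{(−6)}` (`N = 28224`) and `49a1^{(−62)}`
# (`N = 3 013 696`) have the global minimal models `E₋₆ = [0, −126, 0, 4032, 0]`, `E₋₆₂ = [0, −1302, 0, 430528, 0]`,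
# Mordell–Weil rank EXACTLY `1` and `Ш[2] = 0`, UNCONDITIONALLY — and the shape of part (b)

Cell `bsd-print-cf2`, width seat `bsd-line-cf2-p1-w4` g5 (`--supports stmt-BirchSwinnertonDyer-20368`). HONEST FRAMING: theorems about TWO
explicit elliptic curves over `ℚ`; no BSD statement is proved; BSD is not proved by any of this and no summit statement is proved by
this seat. Companion of -w3 g3's `PrintCf2SplitBadRubinValueTwoAnchorsFiveTen.lean` (keys (1,3), (0,3): anchors `−5`, `−10`), which
left the keys (0,5) and (0,1) open because its inert-prime descents need primes `≡ 1 (mod 4)`.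

S4b (registered signature) asks, for every admissible `d` (squarefree, `d ≢ 1 (mod 4)`) of 2-adic key `(d mod 2, d′ mod 8) ≠ (·,7)`,
for SOME anchor `d₀` OF THE SAME KEY with a globally minimal model `W₀` of `cm7^{(d₀)}`, `r_an(W₀) = 1` and `BSD(W₀,2)` — the docstring's
`d₀ ∈ {−5, −6, −10, −30}` names the smallest members, but any member of the key serves. CHOICES made here:
* key **(0,5)** (`d = 2d′`, `d′ ≡ 5 (mod 8)`): `d₀ = −6 = −2·3`, `3 ≡ 3 (mod 8)` INERT in `ℚ(√−7)` — cell bsd-goldfeld's complete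
  `2`-isogeny descent XI `rank_le_one_and_sha_two_twoTorsionModel_twoInertThreeTwist` (`#S·#S′ ≤ 8`) applies at `ℓ = 3`;
* key **(0,1)** (`d′ ≡ 1 (mod 8)`): **`d₀ = −62 = −2·31`** (`−31 ≡ 1 (mod 8)`), `31 ≡ 7 (mod 8)` INERT — descent XVI
  `rank_le_one_and_sha_two_twoTorsionModel_twoInertSevenTwist` at `ℓ = 31`. (The smallest member `−30 = −2·3·5` is not reached by the
  descents now in the tree — the inert families need primes `≡ 1 (mod 4)`, goldfeld's two-prime family C needs `(−7/p) = +1`, false at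
  `p = 5`; `−46 = −2·23` has `23` split and no Bernoulli certificate in the tree. `−62` is the least anchor of key (0,1) with BOTH a tree descent and a tree `r_an = 1` certificate,
  `analyticRank_eq_one_twist_cm7_neg62`.)

LOWER BOUNDS `rank ≥ 1`. On these two models the Silverman–Tate `α`-test used for `−5`/`−10` CANNOT certify infinite order:
`#S(a,b) ≤ 2` forces `α(E(ℚ)) = {1, [7]} = α(E(ℚ)_tors·⟨T₀⟩)`. Instead we use NON-INTEGRAL rational points, which lie in the
formal group and hence have infinite order (Lutz–Nagell / Knapp V Prop. 5.10; tree `not_isOfFinAddOrder_of_one_lt_padicNorm_two_of_a₁`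
at `p = 2`, `one_le_mordellWeilRank_of_dvd_den` at odd `p`):
* `P₋₆ = (1/4, 253/8) ∈ E₋₆(ℚ)` (`(1/4)³ − 126(1/4)² + 4032(1/4) = 64009/64 = (253/8)²`; it is `−2·(63,63)`), `‖1/4‖₂ = 4 > 1`;
* `P₋₆₂ = (7168/9, 127232/27) ∈ E₋₆₂(ℚ)` (found by a 2-cover search on `N² = 7M⁴ − 1302M²e² + 248²e⁴`: `(M,e,N) = (32,3,568)`),
  `3 ∣ den x`.
Global minimality: Kraus at `2` (`2⁸ ∤ c₄ = 2⁶·945`, resp. `2⁶·100905`; `2⁷ ∣ c₆`) and `q⁴ ∤ c₄` or `q¹² ∤ Δ` at odd `q`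
(`Δ(E₋₆) = −2¹⁸·3⁶·7³`, `Δ(E₋₆₂) = −2¹⁸·7³·31⁶`), by the tree's finite check `Rank2Sha.isGloballyMinimal_baseChange_int_of_kraus₂₃_bounded`.
Part (b) shape (as in the −5/−10 file): granted KL19 Thm. 1.20, Modularity, CLTZ Thm. 1.2, Gross–Zagier, Heegner rationality (`r_an = 1`
by name: bsd-goldfeld `analyticRank_eq_one_twist_cm7_neg6` / `_neg62`) and GZK: `Ш[2^∞] = 0`, `corank_{ℤ₂} Sel_{2^∞} = 1` and
**`BSD(W₀,2) ⟺ ∃ q : ℚ, #Ш_an(W₀) = q ∧ ord₂ q = 0`** — the residual numeric datum of each anchor is the `2`-adic unit certificate of `#Ш_an`.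

References: [Knapp1993] V Prop. 5.10; [SilvermanAEC2009] III.1, VII.1 Rem. 1.1, VII.3.4, VIII.6.7, X.4.2, X.4.9; [Kraus1989] Prop. 2;
[KrizLi2019] Thm. 1.20; [Miller2011LMS] Def. 1.1.
-/

noncomputable section

open scoped Classical

open WeierstrassCurve Literature.NumberTheory.EllipticCurves Literature.NumberTheory.EllipticCurves.ModularForms
  Literature.NumberTheory.EllipticCurves.KrizLi2019
  Summit.BirchSwinnertonDyer.BirchSwinnertonDyer.Theorems.GoldfeldGoodTwists

namespace Summit.BirchSwinnertonDyer.BirchSwinnertonDyer.Theorems.PrintCf2.RubinValueTwoAnchor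

/-! ## §0 Plumbing: the two-torsion model as a model of the twist; `p ∣ den x ⇒ ‖x‖_p > 1` -/

/-- **The two-torsion model is a model of the twist**: for every `d ∈ ℤ`, `∃ C₀, C₀ • [0, 21d, 0, 112d², 0] = cm7^{(d)}` (inverse of
bsd-goldfeld's two-torsion change `⟨(mk0 2)⁻¹, 2d, 0, 0⟩`, `smul_eq_twoTorsionModel_of_smul_eq_quadraticTwist`).
[cite: SilvermanAEC2009, III.1 Table 3.1] -/
theorem exists_smul_twoTorsionModel_eq_cm7_quadraticTwist (d : ℤ) :
    ∃ C₀ : VariableChange ℚ, C₀ • (⟨0, ((21 * d : ℤ) : ℚ), 0, ((112 * d ^ 2 : ℤ) : ℚ), 0⟩ : WeierstrassCurve ℚ) =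
      cm7.quadraticTwist (d : ℚ) := by
  have h := smul_eq_twoTorsionModel_of_smul_eq_quadraticTwist d (cm7.quadraticTwist (d : ℚ)) 1 (one_smul _ _)
  rw [mul_one] at h
  exact ⟨(⟨(Units.mk0 (2 : ℚ) two_ne_zero)⁻¹, 2 * (d : ℚ), 0, 0⟩ : VariableChange ℚ)⁻¹, by rw [inv_smul_eq_iff, h]⟩

/-- **`p ∣ den(x) ⇒ ‖x‖_p > 1`** for `x ∈ ℚ` and a prime `p` (`max(1, ‖x‖_p) = p ^ ord_p(den x)`, tree `max_one_norm_ratCast`;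
the tree's copy in `RationalPointInfiniteOrderCriteria` is private, restated). [folklore] -/
theorem one_lt_padicNorm_ratCast_of_dvd_den' (p : ℕ) [Fact p.Prime] {x : ℚ} (hx : p ∣ x.den) : 1 < ‖(x : ℚ_[p])‖ := by
  have hp1 : (1 : ℝ) < p := by exact_mod_cast (Fact.out : p.Prime).one_lt
  have hv : 1 ≤ padicValNat p x.den := one_le_padicValNat_of_dvd x.den_nz hx
  have hlt : (1 : ℝ) < (p : ℝ) ^ (padicValNat p x.den : ℤ) := one_lt_zpow₀ hp1 (by exact_mod_cast hv)
  rw [← WeierstrassCurve.max_one_norm_ratCast p x, lt_max_iff] at hlt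
  exact hlt.resolve_left (lt_irrefl _)

/-! ## §1 Anchor `d₀ = −6` (key (0,5)): `E₋₆ = [0, −126, 0, 4032, 0]` (`49a1^{(−6)}`, `N = 28224`) -/

/-- `E₋₆` is the `ℓ = 3` instance of bsd-goldfeld's inert-two-twist model `[0, −42ℓ, 0, 448ℓ², 0]`. [folklore] -/
theorem E6_eq_twoInertTwist_three : (⟨0, -126, 0, 4032, 0⟩ : WeierstrassCurve ℚ) =
    (⟨0, ((-42 * (3 : ℕ) : ℤ) : ℚ), 0, ((448 * (3 : ℕ) ^ 2 : ℤ) : ℚ), 0⟩ : WeierstrassCurve ℚ) := by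
  ext <;> push_cast <;> norm_num

/-- `E₋₆ = [0, −126, 0, 4032, 0]` is elliptic (`b(a² − 4b) ≠ 0`). [folklore] -/
theorem isElliptic_E6 : (⟨0, -126, 0, 4032, 0⟩ : WeierstrassCurve ℚ).IsElliptic := by
  rw [E6_eq_twoInertTwist_three]
  exact isElliptic_mk_of_ne_zero (F := ℚ) (hab_inertTwoTwist (m := 3) (by norm_num))

/-- **`E₋₆` is a model of `cm7^{(−6)}`**: `∃ C₀, C₀ • E₋₆ = cm7.quadraticTwist (−6)`. [cite: SilvermanAEC2009, III.1 Table 3.1] -/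
theorem exists_smul_E6_eq_cm7_quadraticTwist_neg_six :
    ∃ C₀ : VariableChange ℚ, C₀ • (⟨0, -126, 0, 4032, 0⟩ : WeierstrassCurve ℚ) = cm7.quadraticTwist ((-6 : ℤ) : ℚ) := by
  have e : (⟨0, -126, 0, 4032, 0⟩ : WeierstrassCurve ℚ) =
      ⟨0, ((21 * (-6 : ℤ) : ℤ) : ℚ), 0, ((112 * (-6 : ℤ) ^ 2 : ℤ) : ℚ), 0⟩ := by
    ext <;> push_cast <;> norm_num
  rw [e]
  exact exists_smul_twoTorsionModel_eq_cm7_quadraticTwist (-6)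

/-- `[0, −126, 0, 4032, 0] = ℤ-model ⊗ ℚ`. [folklore] -/
theorem E6_eq_baseChange :
    (⟨0, -126, 0, 4032, 0⟩ : WeierstrassCurve ℚ) = (⟨0, -126, 0, 4032, 0⟩ : WeierstrassCurve ℤ).baseChange ℚ := by
  ext <;> simp [baseChange]

/-- `Δ(E₋₆) = −65548320768 = −2¹⁸·3⁶·7³`, `c₄ = 60480 = 2⁶·3³·5·7`, `c₆ = −18289152 = −2⁹·3⁶·7²` (kernel computation). [folklore] -/
theorem invariants_E6_int : (⟨0, -126, 0, 4032, 0⟩ : WeierstrassCurve ℤ).Δ = -65548320768 ∧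
    (⟨0, -126, 0, 4032, 0⟩ : WeierstrassCurve ℤ).c₄ = 60480 ∧ (⟨0, -126, 0, 4032, 0⟩ : WeierstrassCurve ℤ).c₆ = -18289152 := by
  refine ⟨by decide, by decide, by decide⟩

/-- **`E₋₆ = [0, −126, 0, 4032, 0]` is a GLOBAL MINIMAL MODEL** (Kraus at `2`: `2⁸ ∤ c₄ = 2⁶·945`, `2⁷ ∣ c₆ = −2⁹·35721`; at odd
`q < 10`: `q⁴ ∤ c₄` or `q¹² ∤ Δ`; `|Δ| < 10¹²`) — the tree's finite Kraus–Silverman check. [cite: Kraus1989, Prop. 2]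
[cite: SilvermanAEC2009, VII.1 Remark 1.1] -/
theorem isGloballyMinimal_E6 : (⟨0, -126, 0, 4032, 0⟩ : WeierstrassCurve ℚ).IsGloballyMinimal := by
  rw [E6_eq_baseChange]
  exact Summit.BirchSwinnertonDyer.BirchSwinnertonDyer.Rank2Sha.isGloballyMinimal_baseChange_int_of_kraus₂₃_bounded _
    (B := 10) (by decide) (by decide) (by decide)

/-- The point `P₋₆ = (1/4, 253/8)` lies on `E₋₆`: `(1/4)³ − 126·(1/4)² + 4032·(1/4) = 64009/64 = (253/8)²`. [folklore] -/
theorem nonsingular_E6_quarter : (⟨0, -126, 0, 4032, 0⟩ : WeierstrassCurve ℚ).toAffine.Nonsingular (1 / 4) (253 / 8) := by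
  haveI := isElliptic_E6
  refine (Affine.equation_iff_nonsingular).mp ?_
  rw [Affine.equation_iff']
  norm_num

/-- **`P₋₆ = (1/4, 253/8)` has infinite order in `E₋₆(ℚ)`**: `‖1/4‖₂ > 1`, so `P₋₆` lies in the formal group at `2`, which meets
`E(ℚ)_tors` trivially on a `ℤ`-integral equation with `a₁ = 0` (Knapp V Prop. 5.10 at `p = 2`, tree
`not_isOfFinAddOrder_of_one_lt_padicNorm_two_of_a₁`). [cite: Knapp1993, Ch. V §3 Prop. 5.10 (PDF p. 108)] -/
theorem not_isOfFinAddOrder_quarter_E6 : ¬ IsOfFinAddOrder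
    (Affine.Point.some (1 / 4) (253 / 8) nonsingular_E6_quarter : (⟨0, -126, 0, 4032, 0⟩ : WeierstrassCurve ℚ).toAffine.Point) := by
  haveI := isElliptic_E6
  haveI := isGloballyMinimal_E6
  haveI : Fact (Nat.Prime 2) := ⟨Nat.prime_two⟩
  exact WeierstrassCurve.not_isOfFinAddOrder_of_one_lt_padicNorm_two_of_a₁ _ rfl nonsingular_E6_quarter
    (one_lt_padicNorm_ratCast_of_dvd_den' 2 (by rw [show (1 / 4 : ℚ).den = 4 by norm_num]; norm_num))

/-- **`rank E₋₆(ℚ) ≤ 1`, and `= 1 ⇒ Ш(E₋₆/ℚ)[2] = 0`** — bsd-goldfeld's complete `2`-isogeny descent XI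
`rank_le_one_and_sha_two_twoTorsionModel_twoInertThreeTwist` at `ℓ = 3` (`3 ≡ 3 (mod 8)`, `(−7/3) = −1`).
[cite: SilvermanAEC2009, Thm. X.4.2(a), Prop. X.4.9] -/
theorem rank_le_one_and_sha_two_E6 :
    haveI := isElliptic_E6
    (⟨0, -126, 0, 4032, 0⟩ : WeierstrassCurve ℚ).mordellWeilRank ≤ 1 ∧
      ((⟨0, -126, 0, 4032, 0⟩ : WeierstrassCurve ℚ).mordellWeilRank = 1 →
        ∀ c ∈ (⟨0, -126, 0, 4032, 0⟩ : WeierstrassCurve ℚ).sha, 2 • c = 0 → c = 0) := by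
  haveI := isElliptic_E6
  haveI : (⟨0, ((-42 * (3 : ℕ) : ℤ) : ℚ), 0, ((448 * (3 : ℕ) ^ 2 : ℤ) : ℚ), 0⟩ : WeierstrassCurve ℚ).IsElliptic := by
    rw [← E6_eq_twoInertTwist_three]; exact isElliptic_E6
  have hl7 : legendreSym 3 (-7) = -1 := (legendreSym.eq_neg_one_iff 3).mpr (by unfold IsSquare; decide)
  have h := rank_le_one_and_sha_two_twoTorsionModel_twoInertThreeTwist (l := 3) (by norm_num) hl7
  rw [← E6_eq_twoInertTwist_three] at h
  exact h

/-- **`rank E₋₆(ℚ) = 1`**, UNCONDITIONAL (`≤ 1` by descent, `≥ 1` by `P₋₆` and Mordell–Weil).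
[cite: SilvermanAEC2009, Thm. VIII.6.7, Thm. X.4.2(a)] [cite: Knapp1993, Ch. V §3 Prop. 5.10 (PDF p. 108)] -/
theorem mordellWeilRank_E6 :
    haveI := isElliptic_E6
    (⟨0, -126, 0, 4032, 0⟩ : WeierstrassCurve ℚ).mordellWeilRank = 1 := by
  haveI := isElliptic_E6
  refine le_antisymm rank_le_one_and_sha_two_E6.1 ?_
  refine one_le_mordellWeilRank_of_not_isOfFinAddOrder_rat _ (P := Affine.Point.some (1 / 4) (253 / 8) nonsingular_E6_quarter) ?_
  convert not_isOfFinAddOrder_quarter_E6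

/-- **`Ш(E₋₆/ℚ)[2] = 0`**, UNCONDITIONAL. [cite: SilvermanAEC2009, Thm. X.4.2(a), Prop. X.4.9] -/
theorem forall_mem_sha_two_E6 :
    haveI := isElliptic_E6
    ∀ c ∈ (⟨0, -126, 0, 4032, 0⟩ : WeierstrassCurve ℚ).sha, 2 • c = 0 → c = 0 :=
  rank_le_one_and_sha_two_E6.2 mordellWeilRank_E6

/-- **ANCHOR `d₀ = −6`, PART (a), assembled** (UNCONDITIONAL): `E₋₆` is a globally minimal model of `cm7^{(−6)}` with rank exactly `1`
and `Ш[2] = 0`. [cite: SilvermanAEC2009, Thm. VIII.6.7, Thm. X.4.2(a)] [cite: Kraus1989, Prop. 2] -/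
theorem anchor_neg_six_partA :
    haveI := isElliptic_E6
    (⟨0, -126, 0, 4032, 0⟩ : WeierstrassCurve ℚ).IsGloballyMinimal ∧
      (∃ C₀ : VariableChange ℚ, C₀ • (⟨0, -126, 0, 4032, 0⟩ : WeierstrassCurve ℚ) = cm7.quadraticTwist ((-6 : ℤ) : ℚ)) ∧
      (⟨0, -126, 0, 4032, 0⟩ : WeierstrassCurve ℚ).mordellWeilRank = 1 ∧
      (∀ c ∈ (⟨0, -126, 0, 4032, 0⟩ : WeierstrassCurve ℚ).sha, 2 • c = 0 → c = 0) :=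
  ⟨isGloballyMinimal_E6, exists_smul_E6_eq_cm7_quadraticTwist_neg_six, mordellWeilRank_E6, forall_mem_sha_two_E6⟩

/-- **ANCHOR `d₀ = −6`, the shape of PART (b).** GRANTED Kriz–Li 2019 Thm. 1.20 (`h120`), Modularity (`hnf`), CLTZ 2015 Thm. 1.2 (`h12`),
Gross–Zagier (`hGZ`), Heegner rationality (`hHP`) and GZK (`hGZK`): `r_an(E₋₆) = 1` (bsd-goldfeld `analyticRank_eq_one_twist_cm7_neg6`,
certificate `RouteU.norm_generalizedBernoulli_theta1_E24`), `Ш(E₋₆)[2^∞] = 0`, `corank_{ℤ₂} Sel_{2^∞}(E₋₆) = 1`, and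
**`BSD(E₋₆, 2) ⟺ ∃ q : ℚ, #Ш_an(E₋₆) = q ∧ ord₂ q = 0`**. [cite: KrizLi2019, Thm. 1.20 (pp. 7–8)] [cite: Miller2011LMS, Def. 1.1]
[cite: SilvermanAEC2009, Thm. X.4.2(a), Prop. X.4.9] -/
theorem anchor_neg_six_partB_shape (h120 : thm120_padicLogHeegner_unit_of_bernoulli)
    (hnf : exists_isNewformOf) (h12 : CoatesLiTianZhai2015.thm12_fullBSD_twist)
    (hGZ : ∀ (N : ℕ) [NeZero N] (W : WeierstrassCurve ℚ) (K : Type) [Field K] [NumberField K], gross_zagier N W K)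
    (hHP : ∀ (W : WeierstrassCurve ℚ) (K : Type) [Field K] [NumberField K], exists_isHeegnerPoint W K)
    (hGZK : rank_eq_analyticRank_of_analyticRank_le_one) :
    haveI := isElliptic_E6
    (⟨0, -126, 0, 4032, 0⟩ : WeierstrassCurve ℚ).analyticRank = 1 ∧
      AddCommGroup.primaryComponent (⟨0, -126, 0, 4032, 0⟩ : WeierstrassCurve ℚ).sha 2 = ⊥ ∧
      (⟨0, -126, 0, 4032, 0⟩ : WeierstrassCurve ℚ).selmerCorank 2 = 1 ∧
      (BSDp (⟨0, -126, 0, 4032, 0⟩ : WeierstrassCurve ℚ) 2 ↔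
        ∃ q : ℚ, shaAn (⟨0, -126, 0, 4032, 0⟩ : WeierstrassCurve ℚ) = (q : ℂ) ∧ padicValRat 2 q = 0) := by
  haveI := isElliptic_E6
  obtain ⟨C₀, hC₀⟩ := exists_smul_E6_eq_cm7_quadraticTwist_neg_six
  have har := analyticRank_eq_one_twist_cm7_neg6 h120 hnf h12 hGZ hHP _ C₀ (by rw [hC₀]; norm_num)
  have hl7 : legendreSym 3 (-7) = -1 := (legendreSym.eq_neg_one_iff 3).mpr (by unfold IsSquare; decide)
  obtain ⟨-, hbot, hcork, hiff⟩ := bsdp_two_iff_shaAn_unit_twoInertThreeTwist hGZK (l := 3) (by norm_num) hl7 _ C₀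
    (by rw [hC₀]; norm_num) har
  exact ⟨har, hbot, hcork, hiff⟩

/-! ## §2 Anchor `d₀ = −62` (key (0,1)): `E₋₆₂ = [0, −1302, 0, 430528, 0]` (`49a1^{(−62)}`, `N = 3 013 696`) -/

/-- `E₋₆₂` is the `ℓ = 31` instance of bsd-goldfeld's inert-two-twist model `[0, −42ℓ, 0, 448ℓ², 0]`. [folklore] -/
theorem E62_eq_twoInertTwist_thirtyone : (⟨0, -1302, 0, 430528, 0⟩ : WeierstrassCurve ℚ) =
    (⟨0, ((-42 * (31 : ℕ) : ℤ) : ℚ), 0, ((448 * (31 : ℕ) ^ 2 : ℤ) : ℚ), 0⟩ : WeierstrassCurve ℚ) := by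
  ext <;> push_cast <;> norm_num

/-- `E₋₆₂ = [0, −1302, 0, 430528, 0]` is elliptic. [folklore] -/
theorem isElliptic_E62 : (⟨0, -1302, 0, 430528, 0⟩ : WeierstrassCurve ℚ).IsElliptic := by
  rw [E62_eq_twoInertTwist_thirtyone]
  exact isElliptic_mk_of_ne_zero (F := ℚ) (hab_inertTwoTwist (m := 31) (by norm_num))

/-- **`E₋₆₂` is a model of `cm7^{(−62)}`**: `∃ C₀, C₀ • E₋₆₂ = cm7.quadraticTwist (−62)`. [cite: SilvermanAEC2009, III.1 Table 3.1] -/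
theorem exists_smul_E62_eq_cm7_quadraticTwist_neg_sixtytwo :
    ∃ C₀ : VariableChange ℚ, C₀ • (⟨0, -1302, 0, 430528, 0⟩ : WeierstrassCurve ℚ) = cm7.quadraticTwist ((-62 : ℤ) : ℚ) := by
  have e : (⟨0, -1302, 0, 430528, 0⟩ : WeierstrassCurve ℚ) =
      ⟨0, ((21 * (-62 : ℤ) : ℤ) : ℚ), 0, ((112 * (-62 : ℤ) ^ 2 : ℤ) : ℚ), 0⟩ := by
    ext <;> push_cast <;> norm_num
  rw [e]
  exact exists_smul_twoTorsionModel_eq_cm7_quadraticTwist (-62)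

/-- `[0, −1302, 0, 430528, 0] = ℤ-model ⊗ ℚ`. [folklore] -/
theorem E62_eq_baseChange :
    (⟨0, -1302, 0, 430528, 0⟩ : WeierstrassCurve ℚ) = (⟨0, -1302, 0, 430528, 0⟩ : WeierstrassCurve ℤ).baseChange ℚ := by
  ext <;> simp [baseChange]

/-- `Δ(E₋₆₂) = −79800241378557952 = −2¹⁸·7³·31⁶`, `c₄ = 6457920 = 2⁶·3·5·7·31²`, `c₆ = −20179708416 = −2⁹·3³·7²·31³` (kernel
computation). [folklore] -/
theorem invariants_E62_int : (⟨0, -1302, 0, 430528, 0⟩ : WeierstrassCurve ℤ).Δ = -79800241378557952 ∧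
    (⟨0, -1302, 0, 430528, 0⟩ : WeierstrassCurve ℤ).c₄ = 6457920 ∧
    (⟨0, -1302, 0, 430528, 0⟩ : WeierstrassCurve ℤ).c₆ = -20179708416 := by
  refine ⟨by decide, by decide, by decide⟩

/-- **`E₋₆₂ = [0, −1302, 0, 430528, 0]` is a GLOBAL MINIMAL MODEL** (Kraus at `2`: `2⁸ ∤ c₄ = 2⁶·100905`, `2⁷ ∣ c₆`; at odd `q < 26`:
`q⁴ ∤ c₄` or `q¹² ∤ Δ`; `|Δ| < 26¹²`). [cite: Kraus1989, Prop. 2] [cite: SilvermanAEC2009, VII.1 Remark 1.1] -/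
theorem isGloballyMinimal_E62 : (⟨0, -1302, 0, 430528, 0⟩ : WeierstrassCurve ℚ).IsGloballyMinimal := by
  rw [E62_eq_baseChange]
  exact Summit.BirchSwinnertonDyer.BirchSwinnertonDyer.Rank2Sha.isGloballyMinimal_baseChange_int_of_kraus₂₃_bounded _
    (B := 26) (by decide) (by decide) (by decide)

/-- The point `P₋₆₂ = (7168/9, 127232/27)` lies on `E₋₆₂` (`x = 7·32²/3²`; `N² = 7M⁴ − 1302M²e² + 248²e⁴` at `(M,e,N) = (32,3,568)`).
[folklore] -/
theorem nonsingular_E62_point :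
    (⟨0, -1302, 0, 430528, 0⟩ : WeierstrassCurve ℚ).toAffine.Nonsingular (7168 / 9) (127232 / 27) := by
  haveI := isElliptic_E62
  refine (Affine.equation_iff_nonsingular).mp ?_
  rw [Affine.equation_iff']
  norm_num

/-- **`P₋₆₂` has infinite order in `E₋₆₂(ℚ)`**: `3 ∣ den x(P₋₆₂)` on a global minimal (hence `ℤ`-integral) model (AEC VII.3.4, tree
`not_isOfFinAddOrder_of_dvd_den`). [cite: SilvermanAEC2009, VII.3.4] -/
theorem not_isOfFinAddOrder_point_E62 :
    haveI := isElliptic_E62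
    ¬ IsOfFinAddOrder (Affine.Point.some (7168 / 9) (127232 / 27) nonsingular_E62_point :
      (⟨0, -1302, 0, 430528, 0⟩ : WeierstrassCurve ℚ).toAffine.Point) := by
  haveI := isElliptic_E62
  haveI := isGloballyMinimal_E62
  exact not_isOfFinAddOrder_of_dvd_den _ 3 le_rfl nonsingular_E62_point
    (by rw [show (7168 / 9 : ℚ).den = 9 by norm_num]; norm_num)

/-- `−7` is not a square modulo `31` (`31` is inert in `ℚ(√−7)`). [folklore] -/
theorem not_isSquare_neg_seven_zmod_thirtyone : ¬ IsSquare ((-7 : ℤ) : ZMod 31) := by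
  unfold IsSquare; decide

/-- **`rank E₋₆₂(ℚ) ≤ 1`, and `= 1 ⇒ Ш(E₋₆₂/ℚ)[2] = 0`** — bsd-goldfeld's complete `2`-isogeny descent XVI
`rank_le_one_and_sha_two_twoTorsionModel_twoInertSevenTwist` at `ℓ = 31` (`31 ≡ 7 (mod 8)`, `(−7/31) = −1`).
[cite: SilvermanAEC2009, Thm. X.4.2(a), Prop. X.4.9] -/
theorem rank_le_one_and_sha_two_E62 :
    haveI := isElliptic_E62
    (⟨0, -1302, 0, 430528, 0⟩ : WeierstrassCurve ℚ).mordellWeilRank ≤ 1 ∧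
      ((⟨0, -1302, 0, 430528, 0⟩ : WeierstrassCurve ℚ).mordellWeilRank = 1 →
        ∀ c ∈ (⟨0, -1302, 0, 430528, 0⟩ : WeierstrassCurve ℚ).sha, 2 • c = 0 → c = 0) := by
  haveI := isElliptic_E62
  haveI : Fact (Nat.Prime 31) := ⟨by norm_num⟩
  haveI : (⟨0, ((-42 * (31 : ℕ) : ℤ) : ℚ), 0, ((448 * (31 : ℕ) ^ 2 : ℤ) : ℚ), 0⟩ : WeierstrassCurve ℚ).IsElliptic := by
    rw [← E62_eq_twoInertTwist_thirtyone]; exact isElliptic_E62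
  have hl7 : legendreSym 31 (-7) = -1 := (legendreSym.eq_neg_one_iff 31).mpr not_isSquare_neg_seven_zmod_thirtyone
  have h := rank_le_one_and_sha_two_twoTorsionModel_twoInertSevenTwist (l := 31) (by norm_num) hl7
  rw [← E62_eq_twoInertTwist_thirtyone] at h
  exact h

/-- **`rank E₋₆₂(ℚ) = 1`**, UNCONDITIONAL (`≤ 1` by descent, `≥ 1` by `P₋₆₂` and Mordell–Weil).
[cite: SilvermanAEC2009, VII.3.4, Thm. VIII.6.7, Thm. X.4.2(a)] -/
theorem mordellWeilRank_E62 :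
    haveI := isElliptic_E62
    (⟨0, -1302, 0, 430528, 0⟩ : WeierstrassCurve ℚ).mordellWeilRank = 1 := by
  haveI := isElliptic_E62
  refine le_antisymm rank_le_one_and_sha_two_E62.1 ?_
  refine one_le_mordellWeilRank_of_not_isOfFinAddOrder_rat _
    (P := Affine.Point.some (7168 / 9) (127232 / 27) nonsingular_E62_point) ?_
  convert not_isOfFinAddOrder_point_E62

/-- **`Ш(E₋₆₂/ℚ)[2] = 0`**, UNCONDITIONAL. [cite: SilvermanAEC2009, Thm. X.4.2(a), Prop. X.4.9] -/
theorem forall_mem_sha_two_E62 :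
    haveI := isElliptic_E62
    ∀ c ∈ (⟨0, -1302, 0, 430528, 0⟩ : WeierstrassCurve ℚ).sha, 2 • c = 0 → c = 0 :=
  rank_le_one_and_sha_two_E62.2 mordellWeilRank_E62

/-- **ANCHOR `d₀ = −62`, PART (a), assembled** (UNCONDITIONAL): `E₋₆₂` is a globally minimal model of `cm7^{(−62)}` with rank exactly
`1` and `Ш[2] = 0`. [cite: SilvermanAEC2009, Thm. VIII.6.7, Thm. X.4.2(a)] [cite: Kraus1989, Prop. 2] -/
theorem anchor_neg_sixtytwo_partA :
    haveI := isElliptic_E62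
    (⟨0, -1302, 0, 430528, 0⟩ : WeierstrassCurve ℚ).IsGloballyMinimal ∧
      (∃ C₀ : VariableChange ℚ, C₀ • (⟨0, -1302, 0, 430528, 0⟩ : WeierstrassCurve ℚ) = cm7.quadraticTwist ((-62 : ℤ) : ℚ)) ∧
      (⟨0, -1302, 0, 430528, 0⟩ : WeierstrassCurve ℚ).mordellWeilRank = 1 ∧
      (∀ c ∈ (⟨0, -1302, 0, 430528, 0⟩ : WeierstrassCurve ℚ).sha, 2 • c = 0 → c = 0) :=
  ⟨isGloballyMinimal_E62, exists_smul_E62_eq_cm7_quadraticTwist_neg_sixtytwo, mordellWeilRank_E62, forall_mem_sha_two_E62⟩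

/-- **ANCHOR `d₀ = −62`, the shape of PART (b)** (same five prints + GZK; `r_an = 1` is bsd-goldfeld's
`analyticRank_eq_one_twist_cm7_neg62`, certificate `theta1_twoPrime_q31_sum`): `r_an(E₋₆₂) = 1`, `Ш[2^∞] = 0`, `corank = 1`,
**`BSD(E₋₆₂, 2) ⟺ ord₂ #Ш_an(E₋₆₂) = 0`**. [cite: KrizLi2019, Thm. 1.20 (pp. 7–8)] [cite: Miller2011LMS, Def. 1.1]
[cite: SilvermanAEC2009, Thm. X.4.2(a), Prop. X.4.9] -/
theorem anchor_neg_sixtytwo_partB_shape (h120 : thm120_padicLogHeegner_unit_of_bernoulli)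
    (hnf : exists_isNewformOf) (h12 : CoatesLiTianZhai2015.thm12_fullBSD_twist)
    (hGZ : ∀ (N : ℕ) [NeZero N] (W : WeierstrassCurve ℚ) (K : Type) [Field K] [NumberField K], gross_zagier N W K)
    (hHP : ∀ (W : WeierstrassCurve ℚ) (K : Type) [Field K] [NumberField K], exists_isHeegnerPoint W K)
    (hGZK : rank_eq_analyticRank_of_analyticRank_le_one) :
    haveI := isElliptic_E62
    (⟨0, -1302, 0, 430528, 0⟩ : WeierstrassCurve ℚ).analyticRank = 1 ∧
      AddCommGroup.primaryComponent (⟨0, -1302, 0, 430528, 0⟩ : WeierstrassCurve ℚ).sha 2 = ⊥ ∧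
      (⟨0, -1302, 0, 430528, 0⟩ : WeierstrassCurve ℚ).selmerCorank 2 = 1 ∧
      (BSDp (⟨0, -1302, 0, 430528, 0⟩ : WeierstrassCurve ℚ) 2 ↔
        ∃ q : ℚ, shaAn (⟨0, -1302, 0, 430528, 0⟩ : WeierstrassCurve ℚ) = (q : ℂ) ∧ padicValRat 2 q = 0) := by
  haveI := isElliptic_E62
  haveI : Fact (Nat.Prime 31) := ⟨by norm_num⟩
  obtain ⟨C₀, hC₀⟩ := exists_smul_E62_eq_cm7_quadraticTwist_neg_sixtytwo
  have har := (analyticRank_eq_one_twist_cm7_neg62 h120).2 hnf h12 hGZ hHP _ C₀ (by rw [hC₀]; norm_num)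
  have hl7 : legendreSym 31 (-7) = -1 := (legendreSym.eq_neg_one_iff 31).mpr not_isSquare_neg_seven_zmod_thirtyone
  obtain ⟨-, hbot, hcork, hiff⟩ := bsdp_two_iff_shaAn_unit_twoInertSevenTwist hGZK (l := 31) (by norm_num) hl7 _ C₀
    (by rw [hC₀]; norm_num) har
  exact ⟨har, hbot, hcork, hiff⟩

end Summit.BirchSwinnertonDyer.BirchSwinnertonDyer.Theorems.PrintCf2.RubinValueTwoAnchor

end
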